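import Summits.PneNP.PneNP.Theorems.ConvexRankGatesLinAlgGateBlindMatroidInterCover

/-!
# Route ConvexRankGates, crux `LinAlgGateBlind` (stmt-PneNP-10681): the matroid-intersection door at logarithmic width, unconditionally

Support theorems for the crux (vocabulary of `Theorems/ConvexRankGatesLinAlgGateBlindDefs.lean`). The inline class `MI_t`
(data `u, w : [n] → F^D` over a division ring, any `D`, unbounded fan-in, threshold `θ ≤ t`; ACCEPT iff some `θ` live inputs
have both `(u_i)` and `(w_i)` independent — generic rank `≥ θ` of the rank-one pencil `∑_{live i} X_i u_i w_iᵀ`, Edmonds 1967)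
contains the Kőnig / Hall-cover gates (`u_i = e_{row}`, `w_i = e_{col}`) and the rank-threshold gates `LINRANK_t` (`w_i` in
general position); for rank-one pencils the GRANK door of the tree stops at threshold `m^{7/16-o(1)}` (`sgAt_gRank_logWidth`,
`isGRankGate_iff_threshold`). Here, from the MI cover `sgAt_matroidInter_of_chain_budget` (`(2·#𝒱(L))^t` events):

* `sgAt_matroidInter_logWidth` — for every `c`, eventually in `m`, `SGAt` for `MI_t` for EVERY `t` with
  `2t ≤ m^{7/8}/(log₂ m)^5`, at the logarithmic width `L = (2c+8)(⌊log₂ m⌋+1)`;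
* `monotone_of_matroidInter`, `isTermGate_matroidInter_collapse`, `not_computes_clique_of_isOver_matroidInter_logWidth` —
  by the level-`l` door theorem: NO circuit with `≤ m^c` gates over `{∧₂, ∨₂} ∪ MI_t`, `2t ≤ m^{7/8}/(log₂ m)^5`, computes
  `CLIQUE(m, ⌈m^{1/8}⌉)` (unconditional).

Sources: Edmonds 1967/1970; Razborov 1985, Alon–Boppana 1987 §3; host and budgets are the tree's. No new definitions. [folklore]
-/

-- `Summit.PneNP.PneNP.…` duplicates `PneNP` BY DESIGN (single-problem summit).
set_option linter.dupNamespace false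

noncomputable section

namespace Summit.PneNP.PneNP.Theorems

open Finset Filter Literature.Computability.Complexity Razborov
open Summit.PneNP.PneNP.Cruxes.LinAlgGateBlind.DnfInvariantWideGatesSeeSmallCliques
open Summit.PneNP.PneNP.Cruxes.LinAlgGateBlind.DnfInvariantWideGatesSeeSmallCliques.DenseRegime

/-- **`SGAt` for `MI_t`, `2t ≤ m^{7/8}/(log₂ m)^5`, at the logarithmic width, at every level `c`, eventually in `m`**:
`sgAt_matroidInter_of_chain_budget` with the budgets of `logWidth_common` at `T = (Λ·L + 1)·t + Λ·L` and the cover budget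
`(2·#𝒱(L))^t 2^{-(ν+1)} #𝒱(L) < ε` (`cover_budget_two_pow`). [folklore] -/
theorem sgAt_matroidInter_logWidth : ∀ c : ℕ, ∀ᶠ m : ℕ in atTop, ∀ t : ℕ,
    2 * (t : ℝ) ≤ (m : ℝ) ^ (7 / 8 : ℝ) / Real.logb 2 m ^ 5 →
      SGAt m (fun g => ∃ (F : Type) (_ : DivisionRing F) (D θ : ℕ), θ ≤ t ∧ ∃ u w : Fin g.1 → (Fin D → F),
        ∀ v : Fin g.1 → Bool, g.2 v = true ↔ ∃ I : Finset (Fin g.1), (∀ i ∈ I, v i = true) ∧ #I = θ ∧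
          Module.finrank F (Submodule.span F (u '' (I : Set (Fin g.1)))) = θ ∧
          Module.finrank F (Submodule.span F (w '' (I : Set (Fin g.1)))) = θ)
        ((2 * c + 8) * (Nat.log 2 m + 1)) (kOf m) (qOf m) (epsOf c m) := by
  intro c
  filter_upwards [logWidth_common c] with m hm t ht
  have hT : (((((Nat.log 2 m + 1) * ((2 * c + 8) * (Nat.log 2 m + 1)) + 1) * t +
      (Nat.log 2 m + 1) * ((2 * c + 8) * (Nat.log 2 m + 1)) : ℕ) : ℝ)) ≤
      16 * ((c : ℝ) + 4) * Real.logb 2 m ^ 2 * ((m : ℝ) ^ (7 / 8 : ℝ) / Real.logb 2 m ^ 5) := by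
    obtain ⟨-, -, -, -, -, -, -, -, -, -, hℓ1, h5, hΛL⟩ := hm 0 (by
      push_cast
      exact mul_nonneg (mul_nonneg (by positivity) (sq_nonneg _))
        (div_nonneg (Real.rpow_nonneg (Nat.cast_nonneg m) _) (pow_nonneg (logb_two_nonneg m) 5)))
    have hβ1 : 1 ≤ (m : ℝ) ^ (7 / 8 : ℝ) / Real.logb 2 m ^ 5 := by
      rw [le_div_iff₀ (by positivity), one_mul]; exact h5
    have hc0 : (0 : ℝ) ≤ c := Nat.cast_nonneg c
    have h8 : (2 : ℝ) ≤ 8 * ((c : ℝ) + 4) * Real.logb 2 m ^ 2 := by nlinarith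
    have ht0 : (0 : ℝ) ≤ t := Nat.cast_nonneg t
    push_cast
    set β := (m : ℝ) ^ (7 / 8 : ℝ) / Real.logb 2 m ^ 5 with hβ
    set P := 8 * ((c : ℝ) + 4) * Real.logb 2 m ^ 2 with hP
    set Λ := ((Nat.log 2 m : ℝ) + 1) * ((2 * (c : ℝ) + 8) * ((Nat.log 2 m : ℝ) + 1)) with hΛ
    have hΛ0 : 0 ≤ Λ := by positivity
    have h1 : (Λ + 1) * t ≤ (P + 1) * (β / 2) := mul_le_mul (by linarith) (by linarith) ht0 (by linarith)
    calc (Λ + 1) * t + Λ ≤ (P + 1) * (β / 2) + P := add_le_add h1 hΛL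
      _ ≤ 2 * P * β := by nlinarith
      _ = 16 * ((c : ℝ) + 4) * Real.logb 2 m ^ 2 * β := by rw [hP]; ring
  obtain ⟨hm1, hq0, hq1, hhalf, hε, h2t, -, hpos, hB, hmΛ, -, -, -⟩ := hm _ hT
  refine sgAt_matroidInter_of_chain_budget m _ (kOf m) t _ _ (qOf m) (epsOf c m) hq0 hq1 hhalf hε h2t hpos ?_
  have hV := card_smallSets_le_two_pow m ((2 * c + 8) * (Nat.log 2 m + 1))
  have hVR : (#(smallSets (Fin m) ((2 * c + 8) * (Nat.log 2 m + 1))) : ℝ) ≤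
      (2 : ℝ) ^ ((Nat.log 2 m + 1) * ((2 * c + 8) * (Nat.log 2 m + 1))) := by exact_mod_cast hV
  refine cover_budget_two_pow (a := ((Nat.log 2 m + 1) * ((2 * c + 8) * (Nat.log 2 m + 1)) + 1) * t)
    (Λ := Nat.log 2 m + 1) hm1 (by positivity) ?_ hVR ?_ hmΛ
  · calc ((2 : ℝ) * #(smallSets (Fin m) ((2 * c + 8) * (Nat.log 2 m + 1)))) ^ t
        ≤ ((2 : ℝ) * (2 : ℝ) ^ ((Nat.log 2 m + 1) * ((2 * c + 8) * (Nat.log 2 m + 1)))) ^ t :=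
          pow_le_pow_left₀ (by positivity) (by linarith) t
      _ = (2 : ℝ) ^ (((Nat.log 2 m + 1) * ((2 * c + 8) * (Nat.log 2 m + 1)) + 1) * t) := by
          rw [← pow_succ', ← pow_mul]
  · omega

/-! ### Monotonicity, collapse and the circuit lower bound -/

/-- Matroid-intersection gates are monotone: a common independent set among the live inputs stays live. [folklore] -/
theorem monotone_of_matroidInter {F : Type} [DivisionRing F] {D θ : ℕ} (g : GateFn) (u w : Fin g.1 → (Fin D → F))
    (hg : ∀ v : Fin g.1 → Bool, g.2 v = true ↔ ∃ I : Finset (Fin g.1), (∀ i ∈ I, v i = true) ∧ #I = θ ∧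
      Module.finrank F (Submodule.span F (u '' (I : Set (Fin g.1)))) = θ ∧
      Module.finrank F (Submodule.span F (w '' (I : Set (Fin g.1)))) = θ) : Monotone g.2 :=
  monotone_of_forall_iff hg fun _ _ hvw ⟨I, hI, hcard, hu, hw⟩ =>
    ⟨I, fun i hi => eq_true_of_le_of_eq_true (hvw i) (hI i hi), hcard, hu, hw⟩

/-- **Collapse `MI_t ∘ OR ⊆ MI_t`.** A matroid-intersection gate fed with small-clique DNFs `⌈A_i⌉`, `A_i ⊆ 𝒱(l)`, is a
matroid-intersection term gate over the atoms `X ∈ ⋃ A_i`: repeat the pair `(u_i, w_i)` on every new wire `(i, X)`. A common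
independent `θ`-set of live inputs lifts to one live wire per input; conversely the inputs of a common independent `θ`-set of
live wires are live, pairwise distinct (their `u`-vectors span `θ` dimensions) and common independent. [folklore] -/
theorem isTermGate_matroidInter_collapse (m l t : ℕ) (g : GateFn) (A : Fin g.1 → Finset (Finset (Fin m)))
    (hA : ∀ i, A i ⊆ smallSets (Fin m) l)
    (hg : ∃ (F : Type) (_ : DivisionRing F) (D θ : ℕ), θ ≤ t ∧ ∃ u w : Fin g.1 → (Fin D → F),
      ∀ v : Fin g.1 → Bool, g.2 v = true ↔ ∃ I : Finset (Fin g.1), (∀ i ∈ I, v i = true) ∧ #I = θ ∧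
        Module.finrank F (Submodule.span F (u '' (I : Set (Fin g.1)))) = θ ∧
        Module.finrank F (Submodule.span F (w '' (I : Set (Fin g.1)))) = θ) :
    IsTermGate m (fun g' => ∃ (F : Type) (_ : DivisionRing F) (D θ : ℕ), θ ≤ t ∧ ∃ u w : Fin g'.1 → (Fin D → F),
      ∀ v : Fin g'.1 → Bool, g'.2 v = true ↔ ∃ I : Finset (Fin g'.1), (∀ i ∈ I, v i = true) ∧ #I = θ ∧
        Module.finrank F (Submodule.span F (u '' (I : Set (Fin g'.1)))) = θ ∧
        Module.finrank F (Submodule.span F (w '' (I : Set (Fin g'.1)))) = θ) l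
      (fun x => g.2 fun i => acceptsB (A i) x) := by
  classical
  obtain ⟨F, _, D, θ, hθt, u, w, hg⟩ := hg
  set e := Fintype.equivFin (Σ i : Fin g.1, {X // X ∈ A i}) with he
  set N := Fintype.card (Σ i : Fin g.1, {X // X ∈ A i}) with hN
  set π : Fin N → Fin g.1 := fun a => (e.symm a).1 with hπ
  set R : (Fin N → Bool) → Prop := fun v => ∃ I : Finset (Fin N), (∀ a ∈ I, v a = true) ∧ #I = θ ∧
    Module.finrank F (Submodule.span F ((fun a => u (π a)) '' (I : Set (Fin N)))) = θ ∧
    Module.finrank F (Submodule.span F ((fun a => w (π a)) '' (I : Set (Fin N)))) = θ with hR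
  refine ⟨⟨N, fun v => decide (R v)⟩, ⟨F, inferInstance, D, θ, hθt, fun a => u (π a), fun a => w (π a),
    fun v => decide_eq_true_iff⟩, fun a => ((e.symm a).2 : Finset (Fin m)), fun a => hA _ (e.symm a).2.2, fun x => ?_⟩
  change g.2 (fun i => acceptsB (A i) x) = decide (R fun a => atomB ((e.symm a).2 : Finset (Fin m)) x)
  rw [Bool.eq_iff_iff, hg, decide_eq_true_iff]
  constructor
  · rintro ⟨I, hI, hcard, hu, hw⟩
    -- one live wire per live input
    have hw' : ∀ i ∈ I, ∃ a : Fin N, π a = i ∧ atomB ((e.symm a).2 : Finset (Fin m)) x = true := by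
      intro i hi
      obtain ⟨a, ha, hat⟩ := (acceptsB_eq_true_iff_exists_atom A e x i).1 (hI i hi)
      exact ⟨a, ha, hat⟩
    choose σ hσπ hσlive using hw'
    set I₁ : Finset (Fin N) := I.attach.image fun i => σ i.1 i.2 with hI₁
    have hinj : Function.Injective fun i : {i // i ∈ I} => σ i.1 i.2 := fun i j hij => by
      apply Subtype.ext
      rw [← hσπ i.1 i.2, ← hσπ j.1 j.2]
      exact congrArg π hij
    have himg : ∀ (r : Fin g.1 → (Fin D → F)), (fun a => r (π a)) '' (I₁ : Set (Fin N)) = r '' (I : Set (Fin g.1)) := by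
      intro r
      ext y
      simp only [hI₁, coe_image, coe_attach, Set.image_univ, Set.mem_image, Set.mem_range, mem_coe]
      constructor
      · rintro ⟨a, ⟨⟨i, hi⟩, rfl⟩, rfl⟩
        exact ⟨i, hi, by rw [hσπ i hi]⟩
      · rintro ⟨i, hi, rfl⟩
        exact ⟨σ i hi, ⟨⟨i, hi⟩, rfl⟩, by rw [hσπ i hi]⟩
    refine ⟨I₁, fun a ha => ?_, by rw [hI₁, card_image_of_injective _ hinj, card_attach, hcard], by rw [himg u, hu],
      by rw [himg w, hw]⟩
    obtain ⟨⟨i, hi⟩, -, rfl⟩ := mem_image.1 ha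
    exact hσlive i hi
  · rintro ⟨I', hI', hcard, hu, hw⟩
    have himg_u : u '' ((I'.image π : Finset (Fin g.1)) : Set (Fin g.1)) = (fun a => u (π a)) '' (I' : Set (Fin N)) := by
      rw [coe_image, Set.image_image]
    have himg_w : w '' ((I'.image π : Finset (Fin g.1)) : Set (Fin g.1)) = (fun a => w (π a)) '' (I' : Set (Fin N)) := by
      rw [coe_image, Set.image_image]
    -- the inputs of `I'` are pairwise distinct, since their `u`-vectors span `θ` dimensions
    have hcard' : #(I'.image π) = θ := by
      refine le_antisymm (card_image_le.trans hcard.le) ?_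
      calc θ = Module.finrank F (Submodule.span F (u '' ((I'.image π : Finset (Fin g.1)) : Set (Fin g.1)))) := by
            rw [himg_u, hu]
        _ ≤ #((I'.image π).image u) := by rw [← coe_image]; exact finrank_span_finset_le_card _
        _ ≤ #(I'.image π) := card_image_le
    refine ⟨I'.image π, fun i hi => ?_, hcard', by rw [himg_u, hu], by rw [himg_w, hw]⟩
    obtain ⟨a, ha, rfl⟩ := mem_image.1 hi
    exact (acceptsB_eq_true_iff_exists_atom A e x (π a)).2 ⟨a, rfl, hI' a ha⟩

/-- **No polynomial-size monotone circuit over `{∧₂, ∨₂} ∪ MI_t`, `2t ≤ m^{7/8}/(log₂ m)^5`, computes `CLIQUE(m, ⌈m^{1/8}⌉)`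
(unconditional).** For every `c`, eventually in `m`, for every such `t` and every circuit `C` with `≤ m^c` gates over `{∧₂, ∨₂}`
and MATROID-INTERSECTION gates — accept iff `θ ≤ t` of the live inputs carry both `u`-independent and `w`-independent vectors
(`u, w : [n] → F^D`, any division ring, any `D`, unbounded fan-in; = generic rank `≥ θ` of the rank-one pencil
`∑_{live} X_i u_i w_iᵀ`; Kőnig, Hall-cover and rank-threshold gates are special cases): `¬ C.Computes CLIQUE(m, ⌈m^{1/8}⌉)` — the
level-`l` door theorem with `monotone_of_matroidInter`, `isTermGate_matroidInter_collapse`, `sgAt_matroidInter_logWidth`.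
[folklore] -/
theorem not_computes_clique_of_isOver_matroidInter_logWidth : ∀ c : ℕ, ∀ᶠ m : ℕ in atTop, ∀ t : ℕ,
    2 * (t : ℝ) ≤ (m : ℝ) ^ (7 / 8 : ℝ) / Real.logb 2 m ^ 5 →
    ∀ C : Circuit (KEdge m), C.IsOver ({GateFn.and 2, GateFn.or 2} ∪
      {g : GateFn | ∃ (F : Type) (_ : DivisionRing F) (D θ : ℕ), θ ≤ t ∧ ∃ u w : Fin g.1 → (Fin D → F),
        ∀ v : Fin g.1 → Bool, g.2 v = true ↔ ∃ I : Finset (Fin g.1), (∀ i ∈ I, v i = true) ∧ #I = θ ∧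
          Module.finrank F (Submodule.span F (u '' (I : Set (Fin g.1)))) = θ ∧
          Module.finrank F (Submodule.span F (w '' (I : Set (Fin g.1)))) = θ}) →
      C.size ≤ m ^ c → ¬ C.Computes (cliqueFn m ⌈(m : ℝ) ^ (1 / 8 : ℝ)⌉₊) := by
  intro c
  filter_upwards [not_computes_clique_of_collapse_level c, sgAt_matroidInter_logWidth c, logWidth_le_lOf c]
    with m hhost hSG hLl t ht C hC hsize
  refine hhost ((2 * c + 8) * (Nat.log 2 m + 1)) (Nat.le_mul_of_pos_right _ (Nat.succ_pos _)) hLl _ _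
    (fun g hg => ?_) (fun g hg A hA => isTermGate_matroidInter_collapse m _ t g A hA hg) (hSG t ht) C hC hsize
  obtain ⟨F, _, D, θ, -, u, w, hgu⟩ := hg
  exact monotone_of_matroidInter g u w hgu

end Summit.PneNP.PneNP.Theorems

end
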